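import Mathlib
import Literature.NumberTheory.LFunctions.Zhang2022.Section15CU1LocalLipschitz
import HarnessLib

/-!
# Zhang (2022), Lemma 15.3 value clause (repaired, u053ᴿ): `𝔲ᴿ₁ⱼ(q,1)` against
# `(1−q⁻²)²/(1−χ(q)q⁻²)` — `O((|b₁|+|b₂|+|bⱼ|) log q / q²)` at every prime `q ∤ D`

Topic `Literature/NumberTheory/LFunctions/Zhang2022` (Landau–Siegel audit tree; verdict-neutral).
Y. Zhang, *Discrete mean estimates and the Landau–Siegel zero*, arXiv:2211.02515v1 (2022)
[Zhang2022LandauSiegel] — **an unrefereed manuscript under adjudication; nothing in this file asserts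
or denies its Theorems 1–2.** ZHANG-L discharge lane (WP15), file 9 of the chain towards the leaf
`Typed.Section15C.Lemma153RpI`: App. A u032 in the repaired reading `StepA_u032R`
("`𝔲₁ⱼ(q,1) = (1−q⁻²)²/(1−χ(q)q⁻²) + O(α₁/q)` if `(q,D) = 1`", p. 105, tex L5182) — here with the
summable error `O((|b₁|+|b₂|+|bⱼ|) log q/q²)` and for EVERY prime `q ∤ D` (row D-G-d52-1 (R5):
"StepA_u032R TRUE with room (error O(α log q/q²) ⊂ O(α₁/q))").

What is PROVED here (theorems only; no definitions, no facts): `norm_model_sub_le` (the abstract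
perturbation inequality behind it), `model_eq_main` (the `β = 0` values combine to
`(1−u²)²/(1−vu²)`, `v = ±1`), `frakU1FactorR_one_eq` (`𝔲ᴿ(q,1)` through `Q−1 = λ₁T₁/N`,
`R−1 = ((λ₁−1)+λ₁T₂)/N`), and **`norm_frakU1FactorR_one_sub_main_le`**.

## References

* Y. Zhang, arXiv:2211.02515v1 (2022), §15 Lemma 15.3 p. 87; App. A p. 105 (u031, u032).
  [cite: Zhang2022LandauSiegel, App. A p. 105]
-/

noncomputable section

open Complex Real Filter Topology Finset

namespace Literature.NumberTheory.LFunctions.Zhang2022.Lemma153Rp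

open Literature.NumberTheory.LFunctions.Zhang2022
open Literature.NumberTheory.LFunctions.Zhang2022.Typed.Section15A
open Literature.NumberTheory.LFunctions.Zhang2022.Typed.Section15B

/-! ## §1. The abstract perturbation inequality -/

/-- **Abstract form of the value comparison.** With
`U = 1 − wu + (λT₁/N)u(2−u−w) + (((λ−1)+λT₂)/N)w(2−u−w)` and
`M = 1 − (vu)u + (λ⁰T₁⁰/N⁰)u(2−u−vu) + (((λ⁰−1)+λ⁰T₂⁰)/N⁰)(vu)(2−u−vu)`, the listed size and
perturbation bounds give `‖U − M‖ ≤ ε‖u‖²(14 + 54K(4c_T + 9c_W + 13c_N + 48))`.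
[cite: Zhang2022LandauSiegel, App. A p. 105] -/
theorem norm_model_sub_le {u v w Ni N₀i lam lam₀ T₁ T₁₀ T₂ T₂₀ : ℂ} {ε K cT cW cN : ℝ}
    (hε : 0 ≤ ε) (hK : 0 ≤ K) (hcT : 0 ≤ cT) (hcW : 0 ≤ cW) (hcN : 0 ≤ cN)
    (hu : ‖u‖ ≤ 1 / 2) (hv : ‖v‖ ≤ 1) (hw : ‖w‖ ≤ ‖u‖) (hwv : ‖w - v * u‖ ≤ ‖u‖ * ε)
    (hN : ‖Ni‖ ≤ 18 * K) (hN₀ : ‖N₀i‖ ≤ 1) (hNNi : ‖Ni - N₀i‖ ≤ 18 * K * (cN * ε * ‖u‖))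
    (hlam : ‖lam‖ ≤ 5) (hlam₀ : ‖lam₀‖ ≤ 3 / 2) (hlam1 : ‖lam - 1‖ ≤ 8 * ‖u‖)
    (hlam₀1 : ‖lam₀ - 1‖ ≤ ‖u‖) (hll : ‖lam - lam₀‖ ≤ 4 * ε * ‖u‖)
    (hT₁ : ‖T₁‖ ≤ cT * ‖u‖) (hT₁₀ : ‖T₁₀‖ ≤ 4 * ‖u‖) (hT₁₁ : ‖T₁ - T₁₀‖ ≤ 8 * ε * ‖u‖)
    (hT₂ : ‖T₂‖ ≤ cW * ‖u‖ ^ 2) (hT₂₀ : ‖T₂₀‖ ≤ 4 * ‖u‖ ^ 2) (hT₂₂ : ‖T₂ - T₂₀‖ ≤ 16 * ε * ‖u‖ ^ 2) :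
    ‖(1 - w * u + lam * T₁ * Ni * u * (2 - u - w) + ((lam - 1) + lam * T₂) * Ni * w * (2 - u - w)) -
        (1 - v * u * u + lam₀ * T₁₀ * N₀i * u * (2 - u - v * u) +
          ((lam₀ - 1) + lam₀ * T₂₀) * N₀i * (v * u) * (2 - u - v * u))‖ ≤
      ε * ‖u‖ ^ 2 * (14 + 54 * K * (4 * cT + 9 * cW + 13 * cN + 48)) := by
  set r : ℝ := ‖u‖ with hr
  have hr0 : 0 ≤ r := norm_nonneg _
  have hr1 : r ≤ 1 := by linarith
  have hA : 0 ≤ 18 * K := by positivity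
  have hεr : 0 ≤ ε * r := by positivity
  have hrr : r * r ≤ r := mul_le_of_le_one_left hr0 hr1
  have hr2' : r ^ 2 ≤ r := by rw [sq]; exact hrr
  have hr21 : r ^ 2 ≤ 1 := hr2'.trans hr1
  have hr3' : r ^ 2 * r ≤ r := mul_le_of_le_one_left hr0 hr21
  have hNinv : ‖Ni - N₀i‖ ≤ 18 * K * (cN * ε * r) := hNNi
  -- the pieces
  set Qm : ℂ := lam * T₁ * Ni with hQm
  set Q₀m : ℂ := lam₀ * T₁₀ * N₀i with hQ₀m
  set Rm : ℂ := ((lam - 1) + lam * T₂) * Ni with hRm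
  set R₀m : ℂ := ((lam₀ - 1) + lam₀ * T₂₀) * N₀i with hR₀m
  -- `ΔQ`
  have hΔQ : ‖Qm - Q₀m‖ ≤ ε * r * (18 * K * (4 * cT + 12 + 6 * cN)) := by
    have e : Qm - Q₀m = (lam - lam₀) * T₁ * Ni + lam₀ * (T₁ - T₁₀) * Ni +
        lam₀ * T₁₀ * (Ni - N₀i) := by
      simp only [hQm, hQ₀m]; ring
    rw [e]
    have h1 : ‖(lam - lam₀) * T₁ * Ni‖ ≤ (4 * ε * r) * (cT * r) * (18 * K) := by
      rw [norm_mul, norm_mul]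
      exact mul_le_mul (mul_le_mul hll hT₁ (norm_nonneg _) (by positivity)) hN (norm_nonneg _)
        (by positivity)
    have h2 : ‖lam₀ * (T₁ - T₁₀) * Ni‖ ≤ (3 / 2) * (8 * ε * r) * (18 * K) := by
      rw [norm_mul, norm_mul]
      exact mul_le_mul (mul_le_mul hlam₀ hT₁₁ (norm_nonneg _) (by norm_num)) hN (norm_nonneg _)
        (by positivity)
    have h3 : ‖lam₀ * T₁₀ * (Ni - N₀i)‖ ≤ (3 / 2) * (4 * r) * (18 * K * (cN * ε * r)) := by
      rw [norm_mul, norm_mul]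
      exact mul_le_mul (mul_le_mul hlam₀ hT₁₀ (norm_nonneg _) (by norm_num)) hNinv (norm_nonneg _)
        (by positivity)
    calc _ ≤ (4 * ε * r) * (cT * r) * (18 * K) + (3 / 2) * (8 * ε * r) * (18 * K) +
          (3 / 2) * (4 * r) * (18 * K * (cN * ε * r)) :=
          (norm_add_le _ _).trans (add_le_add ((norm_add_le _ _).trans (add_le_add h1 h2)) h3)
      _ ≤ ε * r * (18 * K * (4 * cT + 12 + 6 * cN)) := by
          have hr2 : r * r ≤ r := hrr
          have ha : (ε * cT * K) * (r * r) ≤ (ε * cT * K) * r :=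
            mul_le_mul_of_nonneg_left hr2 (by positivity)
          have hb : (K * cN * ε) * (r * r) ≤ (K * cN * ε) * r :=
            mul_le_mul_of_nonneg_left hr2 (by positivity)
          linarith
  -- `ΔR`
  have hΔR : ‖Rm - R₀m‖ ≤ ε * r * (18 * K * (28 + 4 * cW + 7 * cN)) := by
    have e : Rm - R₀m = ((lam - lam₀) + (lam - lam₀) * T₂ + lam₀ * (T₂ - T₂₀)) * Ni +
        ((lam₀ - 1) + lam₀ * T₂₀) * (Ni - N₀i) := by
      simp only [hRm, hR₀m]; ring
    rw [e]
    have hr2 : r * r ≤ r := hrr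
    have h1 : ‖(lam - lam₀) + (lam - lam₀) * T₂ + lam₀ * (T₂ - T₂₀)‖ ≤
        4 * ε * r + (4 * ε * r) * (cW * r ^ 2) + (3 / 2) * (16 * ε * r ^ 2) := by
      calc _ ≤ ‖lam - lam₀‖ + ‖(lam - lam₀) * T₂‖ + ‖lam₀ * (T₂ - T₂₀)‖ :=
            (norm_add_le _ _).trans (add_le_add (norm_add_le _ _) le_rfl)
        _ ≤ 4 * ε * r + (4 * ε * r) * (cW * r ^ 2) + (3 / 2) * (16 * ε * r ^ 2) := by
            rw [norm_mul, norm_mul]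
            exact add_le_add (add_le_add hll (mul_le_mul hll hT₂ (norm_nonneg _) (by positivity)))
              (mul_le_mul hlam₀ hT₂₂ (norm_nonneg _) (by norm_num))
    have h1' : 4 * ε * r + (4 * ε * r) * (cW * r ^ 2) + (3 / 2) * (16 * ε * r ^ 2) ≤
        ε * r * (28 + 4 * cW) := by
      have ha : (ε * cW) * (r ^ 2 * r) ≤ (ε * cW) * r := mul_le_mul_of_nonneg_left hr3' (by positivity)
      have hb : ε * (r ^ 2) ≤ ε * r := mul_le_mul_of_nonneg_left hr2' hε
      linarith
    have h2 : ‖(lam₀ - 1) + lam₀ * T₂₀‖ ≤ 7 * r := by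
      calc _ ≤ ‖lam₀ - 1‖ + ‖lam₀ * T₂₀‖ := norm_add_le _ _
        _ ≤ r + (3 / 2) * (4 * r ^ 2) := by
            rw [norm_mul]; exact add_le_add hlam₀1 (mul_le_mul hlam₀ hT₂₀ (norm_nonneg _) (by norm_num))
        _ ≤ 7 * r := by linarith [hr2']
    calc _ ≤ (ε * r * (28 + 4 * cW)) * (18 * K) + (7 * r) * (18 * K * (cN * ε * r)) := by
          refine (norm_add_le _ _).trans (add_le_add ?_ ?_)
          · rw [norm_mul]; exact mul_le_mul (h1.trans h1') hN (norm_nonneg _) (by positivity)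
          · rw [norm_mul]; exact mul_le_mul h2 hNinv (norm_nonneg _) (by positivity)
      _ ≤ ε * r * (18 * K * (28 + 4 * cW + 7 * cN)) := by
          have hb : (K * cN * ε) * (r * r) ≤ (K * cN * ε) * r :=
            mul_le_mul_of_nonneg_left hr2 (by positivity)
          linarith
  -- sizes of `Q₀ − 1`, `R₀ − 1`, `R − 1`
  have hQ₀ : ‖Q₀m‖ ≤ 6 * r := by
    simp only [hQ₀m]; rw [norm_mul, norm_mul]
    calc ‖lam₀‖ * ‖T₁₀‖ * ‖N₀i‖ ≤ (3 / 2) * (4 * r) * 1 :=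
        mul_le_mul (mul_le_mul hlam₀ hT₁₀ (norm_nonneg _) (by norm_num)) hN₀ (norm_nonneg _) (by positivity)
      _ = 6 * r := by ring
  have hR₀ : ‖R₀m‖ ≤ 7 * r := by
    simp only [hR₀m]; rw [norm_mul]
    have h2 : ‖(lam₀ - 1) + lam₀ * T₂₀‖ ≤ 7 * r := by
      calc _ ≤ ‖lam₀ - 1‖ + ‖lam₀ * T₂₀‖ := norm_add_le _ _
        _ ≤ r + (3 / 2) * (4 * r ^ 2) := by
            rw [norm_mul]; exact add_le_add hlam₀1 (mul_le_mul hlam₀ hT₂₀ (norm_nonneg _) (by norm_num))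
        _ ≤ 7 * r := by linarith [hr2']
    calc ‖(lam₀ - 1) + lam₀ * T₂₀‖ * ‖N₀i‖ ≤ 7 * r * 1 := mul_le_mul h2 hN₀ (norm_nonneg _) (by positivity)
      _ = 7 * r := by ring
  have hRm : ‖Rm‖ ≤ 18 * K * (8 + 5 * cW) * r := by
    simp only [hRm]; rw [norm_mul]
    have h2 : ‖(lam - 1) + lam * T₂‖ ≤ (8 + 5 * cW) * r := by
      calc _ ≤ ‖lam - 1‖ + ‖lam * T₂‖ := norm_add_le _ _
        _ ≤ 8 * r + 5 * (cW * r ^ 2) := by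
            rw [norm_mul]; exact add_le_add hlam1 (mul_le_mul hlam hT₂ (norm_nonneg _) (by norm_num))
        _ ≤ (8 + 5 * cW) * r := by
            have : cW * r ^ 2 ≤ cW * r := mul_le_mul_of_nonneg_left hr2' hcW
            linarith
    calc ‖(lam - 1) + lam * T₂‖ * ‖Ni‖ ≤ ((8 + 5 * cW) * r) * (18 * K) :=
        mul_le_mul h2 hN (norm_nonneg _) (by positivity)
      _ = 18 * K * (8 + 5 * cW) * r := by ring
  -- the decomposition
  have hdec : (1 - w * u + Qm * u * (2 - u - w) + Rm * w * (2 - u - w)) -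
      (1 - v * u * u + Q₀m * u * (2 - u - v * u) + R₀m * (v * u) * (2 - u - v * u)) =
      -(u * (w - v * u)) + u * (2 - u - w) * (Qm - Q₀m) + Q₀m * u * (v * u - w) +
        (2 - u - w) * (Rm * (w - v * u) + (Rm - R₀m) * (v * u)) + R₀m * (v * u) * (v * u - w) := by
    ring
  have h2uw : ‖(2 : ℂ) - u - w‖ ≤ 3 := by
    calc ‖(2 : ℂ) - u - w‖ ≤ ‖(2 : ℂ) - u‖ + ‖w‖ := norm_sub_le _ _
      _ ≤ ‖(2 : ℂ)‖ + ‖u‖ + ‖w‖ := by gcongr; exact norm_sub_le _ _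
      _ ≤ 2 + 1 / 2 + 1 / 2 := by
          have : ‖(2 : ℂ)‖ = 2 := by simp
          rw [this]; linarith
      _ = 3 := by norm_num
  have hvu : ‖v * u‖ ≤ r := by
    rw [norm_mul]; calc ‖v‖ * ‖u‖ ≤ 1 * r := by gcongr
      _ = r := one_mul _
  have hwv' : ‖v * u - w‖ ≤ r * ε := by rw [norm_sub_rev]; exact hwv
  change ‖(1 - w * u + Qm * u * (2 - u - w) + Rm * w * (2 - u - w)) -
      (1 - v * u * u + Q₀m * u * (2 - u - v * u) + R₀m * (v * u) * (2 - u - v * u))‖ ≤ _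
  rw [hdec]
  have t1 : ‖-(u * (w - v * u))‖ ≤ r * (r * ε) := by
    rw [norm_neg, norm_mul]; exact mul_le_mul_of_nonneg_left hwv hr0
  have t2 : ‖u * (2 - u - w) * (Qm - Q₀m)‖ ≤ r * 3 * (ε * r * (18 * K * (4 * cT + 12 + 6 * cN))) := by
    rw [norm_mul, norm_mul]
    exact mul_le_mul (mul_le_mul le_rfl h2uw (norm_nonneg _) hr0) hΔQ (norm_nonneg _) (by positivity)
  have t3 : ‖Q₀m * u * (v * u - w)‖ ≤ 6 * r * r * (r * ε) := by
    rw [norm_mul, norm_mul]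
    exact mul_le_mul (mul_le_mul hQ₀ le_rfl hr0 (by positivity)) hwv' (norm_nonneg _) (by positivity)
  have t4 : ‖(2 - u - w) * (Rm * (w - v * u) + (Rm - R₀m) * (v * u))‖ ≤
      3 * ((18 * K * (8 + 5 * cW) * r) * (r * ε) + (ε * r * (18 * K * (28 + 4 * cW + 7 * cN))) * r) := by
    rw [norm_mul]
    refine mul_le_mul h2uw ?_ (norm_nonneg _) (by norm_num)
    calc _ ≤ ‖Rm * (w - v * u)‖ + ‖(Rm - R₀m) * (v * u)‖ := norm_add_le _ _
      _ ≤ (18 * K * (8 + 5 * cW) * r) * (r * ε) + (ε * r * (18 * K * (28 + 4 * cW + 7 * cN))) * r := by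
          rw [norm_mul Rm (w - v * u), norm_mul (Rm - R₀m) (v * u)]
          exact add_le_add (mul_le_mul hRm hwv (norm_nonneg _) (by positivity))
            (mul_le_mul hΔR hvu (norm_nonneg _) (by positivity))
  have t5 : ‖R₀m * (v * u) * (v * u - w)‖ ≤ 7 * r * r * (r * ε) := by
    rw [norm_mul, norm_mul]
    exact mul_le_mul (mul_le_mul hR₀ hvu (norm_nonneg _) (by positivity)) hwv' (norm_nonneg _)
      (by positivity)
  have htot := (norm_add_le _ _).trans (add_le_add ((norm_add_le _ _).trans (add_le_add
    ((norm_add_le _ _).trans (add_le_add ((norm_add_le _ _).trans (add_le_add t1 t2)) t3)) t4)) t5)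
  refine htot.trans ?_
  have hr3 : (ε * (r * r)) * r ≤ (ε * (r * r)) * 1 := mul_le_mul_of_nonneg_left hr1 (by positivity)
  have hsq : ‖u‖ ^ 2 = r * r := by rw [hr, sq]
  rw [hsq]
  linarith

/-! ## §2. The `β = 0` model values combine to `(1−u²)²/(1−vu²)` -/

/-- **The `β = 0` model of `𝔲ᴿ₁ⱼ(q,1)` equals `(1−u²)²/(1−vu²)`** (`v = ±1`, `‖u‖ ≤ 1/2`): with
`λ⁰ = 1 − vu`, `T₁⁰ = (v/(1−u))·u/(1−u)`, `T₂⁰ = −(vu/(1−vu))·u/(1−u)`,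
`N⁰ = 1 + λ⁰(1/(1−vu) − v/(1−u))u/(1−u)`. [cite: Zhang2022LandauSiegel, App. A p. 105] -/
theorem model_eq_main {u v : ℂ} (hu : ‖u‖ ≤ 1 / 2) (hv : v = 1 ∨ v = -1) :
    1 - v * u * u + (1 - v * u) * (v / (1 - u) * (u / (1 - u))) *
        (1 + (1 - v * u) * ((1 / (1 - v * u) - v / (1 - u)) * (u / (1 - u))))⁻¹ * u * (2 - u - v * u) +
      (((1 - v * u) - 1) + (1 - v * u) * (-(v * u / (1 - v * u)) * (u / (1 - u)))) *
        (1 + (1 - v * u) * ((1 / (1 - v * u) - v / (1 - u)) * (u / (1 - u))))⁻¹ * (v * u) *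
          (2 - u - v * u) =
      (1 - u ^ 2) ^ 2 / (1 - v * u ^ 2) := by
  have h1u : (1 : ℂ) - u ≠ 0 := by
    intro h; have : ‖u‖ = 1 := by rw [← sub_eq_zero.mp h]; simp
    linarith
  have h1u' : (1 : ℂ) + u ≠ 0 := by
    intro h
    have : u = -1 := by linear_combination h
    rw [this] at hu; simp at hu; linarith
  have hu2 : ‖u ^ 2‖ ≤ 1 / 4 := by
    rw [norm_pow]; nlinarith [norm_nonneg u]
  have h1u2 : (1 : ℂ) - u ^ 2 ≠ 0 := by
    intro h; have : ‖u ^ 2‖ = 1 := by rw [← sub_eq_zero.mp h]; simp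
    linarith
  have h1u2' : (1 : ℂ) + u ^ 2 ≠ 0 := by
    intro h
    have : u ^ 2 = -1 := by linear_combination h
    rw [this] at hu2; simp at hu2; linarith
  rcases hv with rfl | rfl
  · -- `v = 1`: `N⁰ = 1`
    have hN : (1 : ℂ) + (1 - 1 * u) * ((1 / (1 - 1 * u) - 1 / (1 - u)) * (u / (1 - u))) = 1 := by
      rw [one_mul, sub_self, zero_mul, mul_zero, add_zero]
    rw [hN, inv_one]
    field_simp
    ring
  · -- `v = −1`: `N⁰ = (1+u²)/(1−u)²`
    have e1 : (1 : ℂ) - -1 * u = 1 + u := by ring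
    have hN : (1 : ℂ) + (1 - -1 * u) * ((1 / (1 - -1 * u) - -1 / (1 - u)) * (u / (1 - u))) =
        (1 + u ^ 2) / (1 - u) ^ 2 := by
      rw [e1]; field_simp; ring
    rw [hN, e1]
    have e2 : (1 : ℂ) - -1 * u ^ 2 = 1 + u ^ 2 := by ring
    rw [e2]
    field_simp
    ring

/-! ## §3. `𝔲ᴿ₁ⱼ(q,1)` in the abstract shape -/

variable (c' : ℝ) {D : ℕ} (χ : DirichletCharacter ℂ D)

/-- **`𝔲ᴿ₁ⱼ(q,1) = 1 − wu + (λ₁T₁/N)u(2−u−w) + (((λ₁−1)+λ₁T₂)/N)w(2−u−w)`** with `u = q⁻¹`,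
`w = χ(q)q^{βⱼ}u`, `N = 1 + λ₁(q)Σ_{r≥1}ξ₁(qʳ;1,1)q^{−rs₀}` (`s₀ = 1 − βⱼ`), `T₁`, `T₂` the two
(A.5)-difference series (from `frakU1FactorR_eq_poly` at `s = 1`, `Q − 1 = λ₁T₁/N`,
`R − 1 = ((λ₁−1)+λ₁T₂)/N`, `P − 1 = (Q−1) + (R−1)`). [cite: Zhang2022LandauSiegel, App. A p. 105] -/
theorem frakU1FactorR_one_eq [NeZero D] {q : ℕ} (hq : q.Prime) (hv : χ (q : ZMod D) ^ 2 = 1) (j : ℕ)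
    (hmul : Multipliable fun p : Nat.Primes =>
      calM1Factor c' χ (p : ℕ) 1 1 (1 - Skeleton.betaJ c' D j))
    (hne : calM1 c' χ 1 1 (1 - Skeleton.betaJ c' D j) ≠ 0) :
    Typed.AppendixA2.frakU1FactorR c' χ j q 1 =
      1 - (χ (q : ZMod D) * (q : ℂ) ^ Skeleton.betaJ c' D j * (q : ℂ)⁻¹) * (q : ℂ)⁻¹ +
        lam1 c' χ q 1 *
          (∑' r : ℕ, if r = 0 then (0 : ℂ) else
            χ (q : ZMod D) * (q : ℂ) / ((q : ℂ) - 1) * kappa1 c' D (q ^ (r - 1)) /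
              (q : ℂ) ^ ((r : ℂ) * (1 - Skeleton.betaJ c' D j))) *
          (1 + lam1 c' χ q 1 * xi1LocalSeries c' χ q 1 1 (1 - Skeleton.betaJ c' D j))⁻¹ *
          (q : ℂ)⁻¹ * (2 - (q : ℂ)⁻¹ - χ (q : ZMod D) * (q : ℂ) ^ Skeleton.betaJ c' D j * (q : ℂ)⁻¹) +
        ((lam1 c' χ q 1 - 1) + lam1 c' χ q 1 *
          (∑' r : ℕ, if r = 0 then (0 : ℂ) else
            (kappa1 c' D (q ^ r) - kappaTilde1 c' χ (q ^ r) 1 1) /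
              (q : ℂ) ^ ((r : ℂ) * (1 - Skeleton.betaJ c' D j)))) *
          (1 + lam1 c' χ q 1 * xi1LocalSeries c' χ q 1 1 (1 - Skeleton.betaJ c' D j))⁻¹ *
          (χ (q : ZMod D) * (q : ℂ) ^ Skeleton.betaJ c' D j * (q : ℂ)⁻¹) *
          (2 - (q : ℂ)⁻¹ - χ (q : ZMod D) * (q : ℂ) ^ Skeleton.betaJ c' D j * (q : ℂ)⁻¹) := by
  set s₀ : ℂ := 1 - Skeleton.betaJ c' D j with hs₀
  set u : ℂ := (q : ℂ)⁻¹ with hu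
  set t : ℂ := (q : ℂ) ^ Skeleton.betaJ c' D j with ht
  set v : ℂ := χ (q : ZMod D) with hvdef
  set lam : ℂ := lam1 c' χ q 1 with hlam
  set F00 : ℂ := calM1Factor c' χ q 1 1 s₀ with hF00
  set F01 : ℂ := calM1Factor c' χ q 1 q s₀ with hF01
  set F10 : ℂ := calM1Factor c' χ q q 1 s₀ with hF10
  set F11 : ℂ := calM1Factor c' χ q q q s₀ with hF11
  set S : ℂ := xi1LocalSeries c' χ q 1 1 s₀ with hS
  set N : ℂ := 1 + lam * S with hN
  set Z₀ : ℂ := (1 - (q : ℂ) ^ (-(s₀ + Skeleton.beta1 c' D))) * (1 - (q : ℂ) ^ (-(s₀ + Skeleton.beta2 c' D))) /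
      ((1 - (q : ℂ) ^ (-s₀)) * (1 - χ (q : ZMod D) * (q : ℂ) ^ (-s₀))) with hZ₀
  set T₁ : ℂ := ∑' r : ℕ, (if r = 0 then (0 : ℂ) else
      χ (q : ZMod D) * (q : ℂ) / ((q : ℂ) - 1) * kappa1 c' D (q ^ (r - 1)) /
        (q : ℂ) ^ ((r : ℂ) * s₀)) with hT₁
  set T₂ : ℂ := ∑' r : ℕ, (if r = 0 then (0 : ℂ) else
      (kappa1 c' D (q ^ r) - kappaTilde1 c' χ (q ^ r) 1 1) / (q : ℂ) ^ ((r : ℂ) * s₀)) with hT₂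
  have hs₀re : 0 < s₀.re := by rw [hs₀, one_sub_betaJ_re]; norm_num
  have hF0 : F00 ≠ 0 := calM1Factor_ne_zero_of_calM1_ne_zero c' χ hmul hne ⟨q, hq⟩
  have hZ0 : Z₀ ≠ 0 := zetaPrefactor_ne_zero c' χ hq hs₀re
  have hF00eq : F00 = Z₀ * N := by
    simp only [hF00, hZ₀, hN, hS, hlam]
    unfold calM1Factor
    rw [lamTilde1_prime_one_eq c' χ hq]
  have hNne : N ≠ 0 := by
    intro h0; apply hF0; rw [hF00eq, h0, mul_zero]
  have hA1 : F01 - F00 = Z₀ * (lam * T₁) := calM1Factor_one_prime_sub c' χ hq hs₀re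
  have hA2 : lam * F10 - F00 = Z₀ * ((lam - 1) + lam * T₂) :=
    lam_mul_calM1Factor_prime_one_sub c' χ hq hs₀re
  have hA3 : lam * F11 - F00 = (F01 - F00) + (lam * F10 - F00) :=
    lam_mul_calM1Factor_prime_prime_sub c' χ hq hs₀re
  have hQ : F01 / F00 = 1 + lam * T₁ * N⁻¹ := by
    rw [show F01 = F00 + Z₀ * (lam * T₁) by linear_combination hA1, hF00eq]
    field_simp
  have hR : lam * F10 / F00 = 1 + ((lam - 1) + lam * T₂) * N⁻¹ := by
    rw [show lam * F10 = F00 + Z₀ * ((lam - 1) + lam * T₂) by linear_combination hA2, hF00eq]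
    field_simp
  have hP : lam * F11 / F00 = 1 + lam * T₁ * N⁻¹ + ((lam - 1) + lam * T₂) * N⁻¹ := by
    rw [show lam * F11 = F00 + Z₀ * (lam * T₁) + Z₀ * ((lam - 1) + lam * T₂) by
      linear_combination hA3 + hA1 + hA2, hF00eq]
    field_simp
  rw [frakU1FactorR_eq_poly c' χ hq hv j hmul hne (s := 1) (by norm_num), Complex.cpow_neg_one]
  simp only [← hs₀, ← hu, ← ht, ← hvdef, ← hlam, ← hF00, ← hF01, ← hF10, ← hF11]
  rw [hQ, hR, hP]
  ring

/-- The model normaliser at `v = −1`: `N⁰ = (1+u²)/(1−u)²`. [cite: Zhang2022LandauSiegel, App. A p. 105] -/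
theorem model_N0_neg {u : ℂ} (h1u : (1 : ℂ) - u ≠ 0) (h1u' : (1 : ℂ) + u ≠ 0) :
    (1 : ℂ) + (1 - -1 * u) * ((1 / (1 - -1 * u) - -1 / (1 - u)) * (u / (1 - u))) =
      (1 + u ^ 2) / (1 - u) ^ 2 := by
  have e1 : (1 : ℂ) - -1 * u = 1 + u := by ring
  rw [e1]; field_simp; ring

/-! ## §4. The value bound at a prime `q ∤ D` -/

set_option maxHeartbeats 400000 in
/-- **`‖𝔲ᴿ₁ⱼ(q,1) − (1−q⁻²)²/(1−χ(q)q⁻²)‖ ≤ C(K)·(|b₁|+|b₂|+|bⱼ|) log q/q²`** for every prime `q`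
with `χ(q) = ±1`, whenever the Euler product of `𝓜₁(1,1;1−βⱼ)` converges to a non-zero value and
`‖F_q(1,1;1−βⱼ)‖⁻¹ ≤ 2K`; here `C(K) = 14 + 54K(8Z₂ + 9W² + 13(4K_S + 87) + 48)` with the absolute
series constants `Z₂ = Σ(m+1)²2^{−m}`, `W = Σ(m+2)²2^{−m}`, `K_S = (16/3)Z₂·Σ(k+1)³(3/4)ᵏ`
(App. A u032 in the repaired reading, with a summable error; row D-G-d52-1 (R5)).
[cite: Zhang2022LandauSiegel, App. A p. 105] -/
theorem norm_frakU1FactorR_one_sub_main_le [NeZero D] {q : ℕ} (hq : q.Prime)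
    (hv : χ (q : ZMod D) = 1 ∨ χ (q : ZMod D) = -1) (j : ℕ) {b : ℝ}
    (hb : Skeleton.betaJ c' D j = (b : ℂ) * I)
    (hmul : Multipliable fun p : Nat.Primes =>
      calM1Factor c' χ (p : ℕ) 1 1 (1 - Skeleton.betaJ c' D j))
    (hne : calM1 c' χ 1 1 (1 - Skeleton.betaJ c' D j) ≠ 0) {K : ℝ}
    (hK : ‖calM1Factor c' χ q 1 1 (1 - Skeleton.betaJ c' D j)‖⁻¹ ≤ 2 * K) :
    ‖Typed.AppendixA2.frakU1FactorR c' χ j q 1 -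
        (1 - ((q : ℂ)⁻¹) ^ 2) ^ 2 / (1 - χ (q : ZMod D) * ((q : ℂ)⁻¹) ^ 2)‖ ≤
      (14 + 54 * K * (8 * (∑' m : ℕ, ((m : ℝ) + 1) ^ 2 * (1 / 2 : ℝ) ^ m) +
          9 * (∑' m : ℕ, ((m : ℝ) + 2) ^ 2 * (1 / 2 : ℝ) ^ m) ^ 2 +
          13 * (4 * ((16 / 3) * (∑' k : ℕ, ((k : ℝ) + 1) ^ 2 * (1 / 2 : ℝ) ^ k) *
            (∑' k : ℕ, ((k : ℝ) + 1) ^ 3 * (3 / 4 : ℝ) ^ k)) + 87) + 48)) *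
        ((|Skeleton.b1 c' D| + |Skeleton.b2 c' D| + |b|) * Real.log q) * ((q : ℝ)⁻¹) ^ 2 := by
  set s₀ : ℂ := 1 - Skeleton.betaJ c' D j with hs₀
  set u : ℂ := (q : ℂ)⁻¹ with hu
  set t : ℂ := (q : ℂ) ^ Skeleton.betaJ c' D j with ht
  set v : ℂ := χ (q : ZMod D) with hvdef
  set w : ℂ := v * t * u with hw
  set lam : ℂ := lam1 c' χ q 1 with hlam
  set lam₀ : ℂ := 1 - v * u with hlam₀
  set S : ℂ := xi1LocalSeries c' χ q 1 1 s₀ with hS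
  set A₀ : ℂ := 1 / (1 - v * u) - v / (1 - u) with hA₀
  set S₀ : ℂ := A₀ * (u / (1 - u)) with hS₀
  set N : ℂ := 1 + lam * S with hN
  set N₀ : ℂ := 1 + lam₀ * S₀ with hN₀
  set F00 : ℂ := calM1Factor c' χ q 1 1 s₀ with hF00
  set Z₀ : ℂ := (1 - (q : ℂ) ^ (-(s₀ + Skeleton.beta1 c' D))) * (1 - (q : ℂ) ^ (-(s₀ + Skeleton.beta2 c' D))) /
      ((1 - (q : ℂ) ^ (-s₀)) * (1 - χ (q : ZMod D) * (q : ℂ) ^ (-s₀))) with hZ₀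
  set T₁ : ℂ := ∑' r : ℕ, (if r = 0 then (0 : ℂ) else
      χ (q : ZMod D) * (q : ℂ) / ((q : ℂ) - 1) * kappa1 c' D (q ^ (r - 1)) /
        (q : ℂ) ^ ((r : ℂ) * s₀)) with hT₁
  set T₁₀ : ℂ := v / (1 - u) * (u / (1 - u)) with hT₁₀
  set T₂ : ℂ := ∑' r : ℕ, (if r = 0 then (0 : ℂ) else
      (kappa1 c' D (q ^ r) - kappaTilde1 c' χ (q ^ r) 1 1) / (q : ℂ) ^ ((r : ℂ) * s₀)) with hT₂
  set T₂₀ : ℂ := -(v * u / (1 - v * u)) * (u / (1 - u)) with hT₂₀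
  set Z₂ : ℝ := ∑' m : ℕ, ((m : ℝ) + 1) ^ 2 * (1 / 2 : ℝ) ^ m with hZ₂
  set W : ℝ := ∑' m : ℕ, ((m : ℝ) + 2) ^ 2 * (1 / 2 : ℝ) ^ m with hW
  set Z₃ : ℝ := ∑' k : ℕ, ((k : ℝ) + 1) ^ 3 * (3 / 4 : ℝ) ^ k with hZ₃
  set K_S : ℝ := (16 / 3) * Z₂ * Z₃ with hK_S
  set E : ℝ := (|Skeleton.b1 c' D| + |Skeleton.b2 c' D| + |b|) * Real.log q with hE
  have hZ₂0 : 0 ≤ Z₂ := tsum_nonneg fun m => by positivity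
  have hW0 : 0 ≤ W := tsum_nonneg fun m => by positivity
  have hZ₃0 : 0 ≤ Z₃ := tsum_nonneg fun m => by positivity
  have hK_S0 : 0 ≤ K_S := by rw [hK_S]; positivity
  have hL0 : 0 ≤ Real.log q := Real.log_natCast_nonneg q
  have hE0 : 0 ≤ E := by rw [hE]; positivity
  have hbL : |b| * Real.log q ≤ E := by
    rw [hE]; nlinarith [abs_nonneg (Skeleton.b1 c' D), abs_nonneg (Skeleton.b2 c' D), abs_nonneg b]
  have hbbL : (|Skeleton.b1 c' D| + |Skeleton.b2 c' D|) * Real.log q ≤ E := by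
    rw [hE]; nlinarith [abs_nonneg b]
  have hq0 : (0 : ℝ) < q := by exact_mod_cast hq.pos
  have hq2 : (2 : ℝ) ≤ q := by exact_mod_cast hq.two_le
  have hs₀re : s₀.re = 1 := by rw [hs₀, one_sub_betaJ_re]
  have hs₀pos : 0 < s₀.re := by rw [hs₀re]; norm_num
  have hs₀9 : 9 / 10 < s₀.re := by rw [hs₀re]; norm_num
  have hvn : ‖v‖ ≤ 1 := χ.norm_le_one _
  have hv2 : v ^ 2 = 1 := by
    rcases hv with h | h
    · rw [show v = 1 from h]; norm_num
    · rw [show v = -1 from h]; norm_num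
  have hun : ‖u‖ = (q : ℝ)⁻¹ := by rw [hu, norm_inv, Complex.norm_natCast]
  have hu12 : ‖u‖ ≤ 1 / 2 := by rw [hun, one_div]; exact inv_anti₀ (by norm_num) hq2
  have hu1 : ‖u‖ ≤ 1 := by linarith
  have htn : ‖t‖ = 1 := norm_cpow_betaJ c' hq j
  -- `F00`, `Z₀`, `N`
  have hF0 : F00 ≠ 0 := calM1Factor_ne_zero_of_calM1_ne_zero c' χ hmul hne ⟨q, hq⟩
  have hF0n : 0 < ‖F00‖ := norm_pos_iff.mpr hF0
  have hKpos : 0 ≤ K := by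
    have : 0 < ‖F00‖⁻¹ := inv_pos.mpr hF0n
    linarith
  have hZ0 : Z₀ ≠ 0 := zetaPrefactor_ne_zero c' χ hq hs₀pos
  have hZ9 : ‖Z₀‖ ≤ 9 := norm_zetaPrefactor_le c' χ hq hs₀re
  have hF00eq : F00 = Z₀ * N := by
    simp only [hF00, hZ₀, hN, hS, hlam]
    unfold calM1Factor
    rw [lamTilde1_prime_one_eq c' χ hq]
  have hNne : N ≠ 0 := by intro h0; apply hF0; rw [hF00eq, h0, mul_zero]
  have hNi : ‖N⁻¹‖ ≤ 18 * K := by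
    have e : N⁻¹ = Z₀ * F00⁻¹ := by rw [hF00eq]; field_simp
    rw [e, norm_mul, norm_inv]
    calc ‖Z₀‖ * ‖F00‖⁻¹ ≤ 9 * (2 * K) := mul_le_mul hZ9 hK (by positivity) (by norm_num)
      _ = 18 * K := by ring
  -- `N₀`
  have h1u : (1 : ℂ) - u ≠ 0 := by
    have := AppendixALocal.one_sub_ne_zero hu12 (show ‖(1 : ℂ)‖ ≤ 1 by simp)
    simpa using this
  have hN₀form : N₀ ≠ 0 ∧ ‖N₀⁻¹‖ ≤ 1 := by
    set x : ℝ := (q : ℝ)⁻¹ with hx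
    have hur : u = (x : ℂ) := by rw [hu, hx]; push_cast; rfl
    have hx0 : 0 ≤ x := by positivity
    have hx12 : x ≤ 1 / 2 := by rw [hx, ← one_div]; exact one_div_le_one_div_of_le (by norm_num) hq2
    rcases hv with h1 | h1
    · have hv1 : v = 1 := h1
      have hN1 : N₀ = 1 := by
        simp only [hN₀, hlam₀, hS₀, hA₀, hv1, one_mul]
        rw [sub_self, zero_mul, mul_zero, add_zero]
      rw [hN1]; simp
    · have hv1 : v = -1 := h1
      have h1u' : (1 : ℂ) + u ≠ 0 := by
        intro h; rw [hur] at h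
        have : (x : ℂ) = -1 := by linear_combination h
        have : x = -1 := by exact_mod_cast this
        linarith
      have hN1 : N₀ = (1 + u ^ 2) / (1 - u) ^ 2 := by
        simp only [hN₀, hlam₀, hS₀, hA₀, hv1]
        rw [show (1 : ℂ) - -1 * u = 1 + u by ring] 
        have := model_N0_neg h1u h1u'
        rw [show (1 : ℂ) - -1 * u = 1 + u by ring] at this
        simpa using this
      have hN1r : N₀ = (((1 + x ^ 2) / (1 - x) ^ 2 : ℝ) : ℂ) := by rw [hN1, hur]; push_cast; ring
      have hval : 0 < (1 + x ^ 2) / (1 - x) ^ 2 :=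
        div_pos (by positivity) (pow_pos (by linarith) 2)
      refine ⟨by rw [hN1r]; exact_mod_cast hval.ne', ?_⟩
      rw [hN1r, ← Complex.ofReal_inv, Complex.norm_real, Real.norm_eq_abs, abs_of_pos (inv_pos.mpr hval),
        inv_div, div_le_one (by positivity), show (1 - x) ^ 2 = 1 + x ^ 2 - 2 * x by ring]
      linarith
  obtain ⟨hN₀ne, hN₀i⟩ := hN₀form
  -- `S`, `N − N₀`
  have hSn : ‖S‖ ≤ K_S * ‖u‖ := by
    have h := norm_xi1LocalSeries_le c' χ hq 1 1 hs₀9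
    rw [hs₀re, Real.rpow_neg_one] at h
    rw [hun]; simpa [hS, hK_S, hZ₂, hZ₃, mul_assoc] using h
  have hll : ‖lam - lam₀‖ ≤ 4 * E * ‖u‖ := by
    have h := norm_lam1_sub_model_le c' χ hq
    rw [hun]
    calc ‖lam - lam₀‖ ≤ 4 * ((|Skeleton.b1 c' D| + |Skeleton.b2 c' D|) * Real.log q) * (q : ℝ)⁻¹ := h
      _ ≤ 4 * E * (q : ℝ)⁻¹ := by gcongr
  have hSS : ‖S - S₀‖ ≤ 58 * E * ‖u‖ := by
    have h := norm_S11_sub_model_le c' χ hq j hb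
    rw [hun]; simpa [hS, hS₀, hA₀, hE] using h
  have hlam₀n : ‖lam₀‖ ≤ 3 / 2 := by
    calc ‖lam₀‖ ≤ ‖(1 : ℂ)‖ + ‖v * u‖ := norm_sub_le _ _
      _ ≤ 1 + 1 / 2 := by
          rw [norm_one, norm_mul]; gcongr
          calc ‖v‖ * ‖u‖ ≤ 1 * (1 / 2) := by gcongr
            _ = 1 / 2 := one_mul _
      _ = 3 / 2 := by norm_num
  have hNN : ‖N - N₀‖ ≤ (4 * K_S + 87) * E * ‖u‖ := by
    have e : N - N₀ = (lam - lam₀) * S + lam₀ * (S - S₀) := by simp only [hN, hN₀]; ring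
    rw [e]
    have h1 : ‖(lam - lam₀) * S‖ ≤ (4 * E * ‖u‖) * (K_S * ‖u‖) := by
      rw [norm_mul]; exact mul_le_mul hll hSn (norm_nonneg _) (by positivity)
    have h2 : ‖lam₀ * (S - S₀)‖ ≤ (3 / 2) * (58 * E * ‖u‖) := by
      rw [norm_mul]; exact mul_le_mul hlam₀n hSS (norm_nonneg _) (by norm_num)
    have h3 : (4 * E * ‖u‖) * (K_S * ‖u‖) ≤ 4 * K_S * E * ‖u‖ := by
      have hKu : K_S * ‖u‖ ≤ K_S := mul_le_of_le_one_right hK_S0 hu1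
      have h0 : 0 ≤ 4 * E * ‖u‖ := by positivity
      calc (4 * E * ‖u‖) * (K_S * ‖u‖) ≤ (4 * E * ‖u‖) * K_S := mul_le_mul_of_nonneg_left hKu h0
        _ = 4 * K_S * E * ‖u‖ := by ring
    calc _ ≤ (4 * E * ‖u‖) * (K_S * ‖u‖) + (3 / 2) * (58 * E * ‖u‖) :=
          (norm_add_le _ _).trans (add_le_add h1 h2)
      _ ≤ (4 * K_S + 87) * E * ‖u‖ := by linarith
  have hNNi : ‖N⁻¹ - N₀⁻¹‖ ≤ 18 * K * ((4 * K_S + 87) * E * ‖u‖) := by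
    have e : N⁻¹ - N₀⁻¹ = N⁻¹ * N₀⁻¹ * (N₀ - N) := by field_simp
    rw [e, norm_mul, norm_mul, norm_sub_rev]
    calc ‖N⁻¹‖ * ‖N₀⁻¹‖ * ‖N - N₀‖ ≤ 18 * K * 1 * ((4 * K_S + 87) * E * ‖u‖) :=
        mul_le_mul (mul_le_mul hNi hN₀i (norm_nonneg _) (by positivity)) hNN (norm_nonneg _) (by positivity)
      _ = _ := by ring
  -- `T₁`, `T₂`
  have hT₁n : ‖T₁‖ ≤ 2 * Z₂ * ‖u‖ := by
    have h := norm_tsum_right_diff_le c' χ hq hs₀re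
    rw [hun]; simpa [hT₁, hZ₂, div_eq_mul_inv] using h
  have hT₁₀n : ‖T₁₀‖ ≤ 4 * ‖u‖ := by
    rw [hT₁₀, norm_mul]
    have h1 : ‖v / (1 - u)‖ ≤ 2 := AppendixALocal.norm_div_one_sub_le_two hu12 hvn
    have h2 : ‖u / (1 - u)‖ ≤ 2 * ‖u‖ := by
      rw [norm_div]
      have := AppendixALocal.half_le_norm_one_sub hu12 (show ‖(1 : ℂ)‖ ≤ 1 by simp)
      rw [one_mul] at this
      rw [div_le_iff₀ (by linarith)]
      calc ‖u‖ = 2 * ‖u‖ * (1 / 2) := by ring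
        _ ≤ 2 * ‖u‖ * ‖1 - u‖ := by gcongr
    calc ‖v / (1 - u)‖ * ‖u / (1 - u)‖ ≤ 2 * (2 * ‖u‖) := mul_le_mul h1 h2 (norm_nonneg _) (by norm_num)
      _ = 4 * ‖u‖ := by ring
  have hT₁₁ : ‖T₁ - T₁₀‖ ≤ 8 * E * ‖u‖ := by
    have h := norm_T1_sub_le c' χ hq j hb
    rw [chi_mul_div_sub_one_eq χ hq] at h
    have h' : ‖T₁ - χ (q : ZMod D) / (1 - (q : ℂ)⁻¹) * ((q : ℂ)⁻¹ / (1 - (q : ℂ)⁻¹))‖ ≤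
        8 * ((|Skeleton.b1 c' D| + |Skeleton.b2 c' D| + |b|) * Real.log q) * (q : ℝ)⁻¹ := by
      simpa [hT₁, chi_mul_div_sub_one_eq χ hq] using h
    rw [hun]
    simpa [hT₁₀, hvdef, hu, hE] using h'
  have hT₂n : ‖T₂‖ ≤ W ^ 2 * ‖u‖ ^ 2 := by
    have h := norm_tsum_left_diff_le c' χ hq hs₀re
    rw [hun, inv_pow]; simpa [hT₂, hW, div_eq_mul_inv] using h
  have hT₂₀n : ‖T₂₀‖ ≤ 4 * ‖u‖ ^ 2 := by
    rw [hT₂₀, norm_mul, norm_neg]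
    have h1 : ‖v * u / (1 - v * u)‖ ≤ 2 * ‖u‖ := by
      rw [norm_div, norm_mul]
      have := AppendixALocal.half_le_norm_one_sub hu12 hvn
      rw [div_le_iff₀ (by linarith)]
      calc ‖v‖ * ‖u‖ ≤ 1 * ‖u‖ := by gcongr
        _ = 2 * ‖u‖ * (1 / 2) := by ring
        _ ≤ 2 * ‖u‖ * ‖1 - v * u‖ := by gcongr
    have h2 : ‖u / (1 - u)‖ ≤ 2 * ‖u‖ := by
      rw [norm_div]
      have := AppendixALocal.half_le_norm_one_sub hu12 (show ‖(1 : ℂ)‖ ≤ 1 by simp)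
      rw [one_mul] at this
      rw [div_le_iff₀ (by linarith)]
      calc ‖u‖ = 2 * ‖u‖ * (1 / 2) := by ring
        _ ≤ 2 * ‖u‖ * ‖1 - u‖ := by gcongr
    calc ‖v * u / (1 - v * u)‖ * ‖u / (1 - u)‖ ≤ (2 * ‖u‖) * (2 * ‖u‖) :=
        mul_le_mul h1 h2 (norm_nonneg _) (by positivity)
      _ = 4 * ‖u‖ ^ 2 := by ring
  have hT₂₂ : ‖T₂ - T₂₀‖ ≤ 16 * E * ‖u‖ ^ 2 := by
    have h := norm_T2_sub_le c' χ hq j hb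
    rw [hun]; simpa [hT₂, hT₂₀, hvdef, hu, hE] using h
  -- `w`
  have hwn : ‖w‖ ≤ ‖u‖ := by
    rw [hw, norm_mul, norm_mul, htn, mul_one]
    calc ‖v‖ * ‖u‖ ≤ 1 * ‖u‖ := by gcongr
      _ = ‖u‖ := one_mul _
  have hwv : ‖w - v * u‖ ≤ ‖u‖ * E := by
    rw [hw, show v * t * u - v * u = v * u * (t - 1) by ring, norm_mul, norm_mul]
    have := norm_cpow_betaJ_sub_one_le c' hq j hb
    rw [← ht] at this
    calc ‖v‖ * ‖u‖ * ‖t - 1‖ ≤ 1 * ‖u‖ * (|b| * Real.log q) := by gcongr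
      _ ≤ ‖u‖ * E := by rw [one_mul]; exact mul_le_mul_of_nonneg_left hbL (norm_nonneg _)
  have hlamn : ‖lam‖ ≤ 5 := norm_lam1_prime_one_le c' χ hq
  have hlam1 : ‖lam - 1‖ ≤ 8 * ‖u‖ := by
    rw [hun, ← div_eq_mul_inv]; exact norm_lam1_prime_one_sub_one_le c' χ hq
  have hlam₀1 : ‖lam₀ - 1‖ ≤ ‖u‖ := by
    rw [hlam₀, show (1 : ℂ) - v * u - 1 = -(v * u) by ring, norm_neg, norm_mul]
    calc ‖v‖ * ‖u‖ ≤ 1 * ‖u‖ := by gcongr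
      _ = ‖u‖ := one_mul _
  -- the abstract inequality
  have key := norm_model_sub_le (u := u) (v := v) (w := w) (Ni := N⁻¹) (N₀i := N₀⁻¹) (lam := lam)
    (lam₀ := lam₀) (T₁ := T₁) (T₁₀ := T₁₀) (T₂ := T₂) (T₂₀ := T₂₀) (ε := E) (K := K)
    (cT := 2 * Z₂) (cW := W ^ 2) (cN := 4 * K_S + 87) hE0 hKpos (by positivity) (by positivity)
    (by positivity) hu12 hvn hwn hwv hNi hN₀i hNNi hlamn hlam₀n hlam1 hlam₀1 hll hT₁n hT₁₀n hT₁₁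
    hT₂n hT₂₀n hT₂₂
  -- identify both sides
  have hU : Typed.AppendixA2.frakU1FactorR c' χ j q 1 =
      1 - w * u + lam * T₁ * N⁻¹ * u * (2 - u - w) + ((lam - 1) + lam * T₂) * N⁻¹ * w * (2 - u - w) :=
    frakU1FactorR_one_eq c' χ hq hv2 j hmul hne
  have hM : 1 - v * u * u + lam₀ * T₁₀ * N₀⁻¹ * u * (2 - u - v * u) +
      ((lam₀ - 1) + lam₀ * T₂₀) * N₀⁻¹ * (v * u) * (2 - u - v * u) = (1 - u ^ 2) ^ 2 / (1 - v * u ^ 2) :=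
    model_eq_main hu12 hv
  rw [hU, ← hM]
  refine key.trans (le_of_eq ?_)
  rw [hun]
  ring

end Literature.NumberTheory.LFunctions.Zhang2022.Lemma153Rp


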